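import Summits.KontsevichZagierPeriods.KontsevichZagierPeriods.Theorems.KzOnePeriodsLadder
import Literature.NumberTheory.Transcendental.HuberWustholz2022.MainTheorems
import Literature.NumberTheory.Transcendental.CurvePeriods

/-!
# KontsevichZagierPeriods — the transfer schema: how "all relations are induced" statements enter the KZ ladder

Cell pub-kz1p (KZ 1-periods), seat b2b-kz1p-1 (LEAN-IN-TREE migration of the staging package's `Rung1.lean` and of the KZ-side
part of its `HuberWustholz.lean`).  HONEST FRAMING: this file proves NO rung unconditionally.  It isolates, as ONE abstract
lemma of additive algebra, the exact shape in which a Huber–Wüstholz-type theorem ("all ℚ̄-linear relations between the periods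
of a period structure `𝔻` are induced by its relators", `PeriodStructure.AllRelationsInduced`, tree Literature
`HuberWustholz2022/PeriodStructures.lean`) yields a rung `KZ_≤d` of the dimension ladder (`KzOnePeriodsLadder.lean`): one needs
in addition a TRANSFER DATUM `TransferDatum 𝔻 R d` — an additive map from formal combinations of `𝔻`-symbols to a group into which
`KZ.FormalRep ⧸ R` embeds, killing algebraic multiples of relators and matching every KZ representation of dimension `≤ d` with
an algebraic-coefficient combination of the same value.  Then (`sub_mem_of_transfer`, ten lines) equal values in dimensions
`≤ d` give `[r] − [r'] ∈ R`; with `R = KZ.relations` this is `KZ_le d`, with `R = KZ.relationsLE d` the truncated `KZ_leLE d`.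

Instances of the schema recorded here (all with BOTH hypotheses explicit — nothing is asserted to exist):
* the CURVE period structure of the tree's elementary rendering `HuberWustholzCurvePeriods` of [HW, Thm 13.3(2) p. 121]
  (`curvePeriodStructure`; `allRelationsInduced_curve_iff : … ↔ HuberWustholzCurvePeriods` is `Iff.rfl`), giving
  `KZ_le_one_of_transfer` / `KZ_leLE_one_of_transfer`.  For `R = KZ.relations` the CONCLUSION is already a tree theorem
  from the rendering alone (`kz_le_one_of_huberWustholzCurvePeriods`, `Theorems/KzOnePeriodsRungOneOfHW.lean`: the relators are
  realised by planar scissors moves through dimension 2, `SymplecticScissors.PlanarTransport` + `AbelContraction.AreasToArcs`),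
  which makes the schema instance redundant for that `R` — no `TransferDatum` instance is constructed anywhere; for
  `R = KZ.relationsLE 1` NO landed theorem gives either the datum or the conclusion (every known realisation of the curve
  relators uses 2-dimensional bands) — this is the cell's gap G-LE1, whose transfer form
  `TransferDatum curvePeriodStructure (relationsLE 1) 1` appears here only as a hypothesis;
* the VERBATIM-SCHEMATIC [HW, Thm 13.3(2)] and (3) over posited realisation data `D : HWData`
  (`Literature/…/HuberWustholz2022/MainTheorems.lean`): `KZ_le_one_of_HW_Thm13_3_2`, `KZ_leLE_one_of_HW_Thm13_3_2`,
  `KZ_le_one_of_HW_Thm13_3_3` — the form through which the printed theorem (rather than the tree's rendering) would enter.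

References: [HW] A. Huber, G. Wüstholz, *Transcendence and Linear Relations of 1-Periods*, Cambridge Tracts 227 (2022),
Def. 7.15 p. 65, §13.1 (A)(B)(C) p. 120–121, Thm 13.3 p. 121, Def. 12.6 / Cor. 12.7 p. 116; [KZ] M. Kontsevich, D. Zagier,
*Periods* (2001), §1.2 Conjecture 1.  Cell files: GAPS.md (G0, G-D1, G-LE1, G4), DIVERGENCE.md D-1 (rendering deltas).
[cite: HuberWustholz2022, Thm 13.3 p.121] [cite: KontsevichZagier2001, §1.2]
-/

noncomputable section

open scoped BigOperators

namespace Summit.KontsevichZagierPeriods.KzOnePeriods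

open Literature.NumberTheory.Transcendental
open Literature.NumberTheory.Transcendental.KZ
open Literature.NumberTheory.Transcendental.HuberWustholz2022

/-! ### The transfer datum and the abstract rung lemma -/

/-- **Transfer datum** (`TransferDatum`) from a period structure `𝔻` into the KZ calculus modulo a subgroup `R ⊆ KZ.FormalRep` of moves, for
representations of dimension `≤ d`: a receptacle `V`, an additive `τ : (Sym →₀ ℂ) → V` killing algebraic multiples of relators, an
INJECTIVE additive `κ : FormalRep ⧸ R → V`, and for every KZ representation `r` of dimension `≤ d` an algebraic-coefficient
combination `c` of `𝔻`-symbols with `eval c = value r` and `τ c = κ [r]`.  A HYPOTHESIS SCHEMA (cell GAPS.md G1–G3), not a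
result of [HW]; no instance is constructed in this file. -/
def TransferDatum (𝔻 : PeriodStructure) (R : AddSubgroup FormalRep) (d : ℕ) : Prop :=
  ∃ (V : Type) (_ : AddCommGroup V) (τ : (𝔻.Sym →₀ ℂ) →+ V) (κ : FormalRep ⧸ R →+ V),
    Function.Injective κ ∧
    (∀ (ρ : 𝔻.Sym →₀ ℂ) (a : ℂ), 𝔻.IsRelator ρ → IsAlgebraic ℚ a → τ (a • ρ) = 0) ∧
    (∀ (n : ℕ) (r : IntegralRep n), n ≤ d →
      ∃ c : 𝔻.Sym →₀ ℂ, 𝔻.AlgCoeffs c ∧ 𝔻.eval c = (r.value : ℂ) ∧ τ c = κ (of r : FormalRep ⧸ R))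

/-- **The abstract rung lemma.**  If all algebraic-coefficient relations of `𝔻` are induced by the relators, and `𝔻` transfers
into `KZ.FormalRep ⧸ R` in dimensions `≤ d`, then two KZ representations of dimensions `≤ d` with the same value differ by an
element of `R`.  Proof: the difference of the two comparison combinations has algebraic coefficients and evaluates to `0`, hence
is an algebraic combination of relators, hence dies under `τ`; so `κ [r] = κ [r']`, and `κ` is injective. -/
theorem sub_mem_of_transfer {𝔻 : PeriodStructure} {R : AddSubgroup FormalRep} {d : ℕ}
    (hHW : 𝔻.AllRelationsInduced) (hT : TransferDatum 𝔻 R d)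
    {n m : ℕ} (hn : n ≤ d) (hm : m ≤ d) (r : IntegralRep n) (r' : IntegralRep m)
    (hv : r.value = r'.value) : of r - of r' ∈ R := by
  obtain ⟨V, _, τ, κ, hκ, hτ, hcmp⟩ := hT
  obtain ⟨c, hc, hce, hcτ⟩ := hcmp n r hn
  obtain ⟨c', hc', hce', hcτ'⟩ := hcmp m r' hm
  -- the difference is an algebraic-coefficient relation of `𝔻`
  have h0 : 𝔻.eval (c - c') = 0 := by rw [map_sub, hce, hce', hv, sub_self]
  obtain ⟨k, ρ, a, hρ, ha, hsum⟩ := hHW (c - c') (hc.sub hc') h0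
  -- hence it dies under `τ`
  have hτ0 : τ (c - c') = 0 := by
    rw [hsum, map_sum]
    exact Finset.sum_eq_zero fun l _ => hτ (ρ l) (a l) (hρ l) (ha l)
  have hκeq : κ (of r : FormalRep ⧸ R) = κ (of r' : FormalRep ⧸ R) := by
    rw [← hcτ, ← hcτ', ← sub_eq_zero, ← map_sub, hτ0]
  have heq : (of r : FormalRep ⧸ R) = (of r' : FormalRep ⧸ R) := hκ hκeq
  rw [QuotientAddGroup.eq_iff_sub_mem] at heq
  exact heq

/-- With `R = KZ.relations` the abstract rung lemma concludes rung `KZ_le d`. -/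
theorem KZ_le_of_transfer {𝔻 : PeriodStructure} {d : ℕ} (hHW : 𝔻.AllRelationsInduced) (hT : TransferDatum 𝔻 relations d) :
    KZ_le d :=
  fun _ _ hn hm r r' hv => sub_mem_of_transfer hHW hT hn hm r r' hv

/-- With `R = KZ.relationsLE d` the abstract rung lemma concludes the truncated rung `KZ_leLE d`. -/
theorem KZ_leLE_of_transfer {𝔻 : PeriodStructure} {d : ℕ} (hHW : 𝔻.AllRelationsInduced)
    (hT : TransferDatum 𝔻 (relationsLE d) d) : KZ_leLE d :=
  fun _ _ hn hm r r' hv => sub_mem_of_transfer hHW hT hn hm r r' hv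

/-- A transfer datum modulo `R` is a transfer datum modulo any larger subgroup `R'` into which `FormalRep ⧸ R'` still embeds —
in the only generality that is free: shrinking the dimension bound. -/
theorem TransferDatum.mono_dim {𝔻 : PeriodStructure} {R : AddSubgroup FormalRep} {d d' : ℕ} (hd : d ≤ d')
    (hT : TransferDatum 𝔻 R d') : TransferDatum 𝔻 R d := by
  obtain ⟨V, _, τ, κ, hκ, hτ, hcmp⟩ := hT
  exact ⟨V, inferInstance, τ, κ, hκ, hτ, fun n r hn => hcmp n r (hn.trans hd)⟩

/-! ### The curve period structure of the tree's rendering of [HW, Thm 13.3(2)] -/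

/-- `CurvePeriods.evalCombination` (`Σ c_s ∫_{γ_s} ω_s`) as an additive homomorphism. -/
def curveEval : (CurvePeriods.PeriodSymbol →₀ ℂ) →+ ℂ where
  toFun := CurvePeriods.evalCombination
  map_zero' := by simp [CurvePeriods.evalCombination]
  map_add' c c' := by
    unfold CurvePeriods.evalCombination
    exact Finsupp.sum_add_index' (fun _ => zero_mul _) (fun _ _ _ => add_mul _ _ _)

/-- `curveEval` is `CurvePeriods.evalCombination`. -/
@[simp] theorem curveEval_apply (c : CurvePeriods.PeriodSymbol →₀ ℂ) :
    curveEval c = CurvePeriods.evalCombination c := rfl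

/-- The **curve period structure**: symbols `(Z, ω, γ)` of curve type on embedded smooth affine curves [HW, Def. 12.6 p. 116,
tree rendering `CurvePeriods.PeriodSymbol`], evaluation `Σ c_s ∫_{γ_s} ω_s`, relators = the tree's elementary relations
`CurvePeriods.IsElementaryRelation` (bilinearity, vanishing and exact forms, functoriality along polynomial maps, boundaries)
[HW, §13.1 (A)(B)(C) p. 120: bilinearity / functoriality / boundary maps]. -/
def curvePeriodStructure : PeriodStructure where
  Sym := CurvePeriods.PeriodSymbol
  eval := curveEval
  IsRelator := CurvePeriods.IsElementaryRelation

/-- The abstract "all relations induced" over the curve period structure IS the tree's rendering `HuberWustholzCurvePeriods`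
of [HW, Thm 13.3(2)] — definitionally. -/
theorem allRelationsInduced_curve_iff :
    curvePeriodStructure.AllRelationsInduced ↔ HuberWustholzCurvePeriods :=
  Iff.rfl

/-- **Rung 1 from the rendering plus a curve transfer datum, full calculus (SCHEMA).**  For this `R` the conclusion is
already a tree theorem from the rendering ALONE (`kz_le_one_of_huberWustholzCurvePeriods`, `Theorems/KzOnePeriodsRungOneOfHW.lean`,
by planar scissors moves), so the schema instance is redundant here — no `TransferDatum` instance is constructed anywhere; the
schema is kept as the form through which the verbatim-schematic `HW_Thm13_3_2` enters (`KZ_le_one_of_HW_Thm13_3_2`). -/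
theorem KZ_le_one_of_transfer (hHW : HuberWustholzCurvePeriods) (hT : TransferDatum curvePeriodStructure relations 1) :
    KZ_le 1 :=
  KZ_le_of_transfer (allRelationsInduced_curve_iff.2 hHW) hT

/-- **Rung 1 in the TRUNCATED calculus from the rendering — CONDITIONAL on a curve transfer datum into
`KZ.FormalRep ⧸ KZ.relationsLE 1`** (moves among representations of dimension `≤ 1` only; cell gap G-LE1 in transfer form).
OPEN: no landed theorem provides such a datum (the tree's realisation of the curve relators passes through 2-dimensional bands,
`AbelContraction.AreasToArcs`); it contains in particular the injectivity of `FormalRep ⧸ relationsLE 1 → V`, a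
torsion/faithfulness question for the truncated calculus.  Recorded, not claimed:
`HuberWustholzCurvePeriods → TransferDatum curvePeriodStructure (relationsLE 1) 1 → KZ_leLE 1`. -/
theorem KZ_leLE_one_of_transfer (hHW : HuberWustholzCurvePeriods)
    (hT : TransferDatum curvePeriodStructure (relationsLE 1) 1) : KZ_leLE 1 :=
  KZ_leLE_of_transfer (allRelationsInduced_curve_iff.2 hHW) hT

/-- The rational-shape rung from the schema (UNCONDITIONALLY a tree theorem, from Baker: `LowdimBaker0DimLeOne`; recorded only
to place the rungs on one ladder). -/
theorem KZ_leRat_one_of_transfer (hHW : HuberWustholzCurvePeriods) (hT : TransferDatum curvePeriodStructure relations 1) :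
    KZ_leRat 1 :=
  KZ_leRat_of_KZ_le (KZ_le_one_of_transfer hHW hT)

/-! ### Rung 1 from the verbatim-schematic [HW, Thm 13.3(2)/(3)] over posited data -/

/-- **Rung 1 from [HW, Thm 13.3(2)] typed verbatim-schematically**: for ANY posited realisation data `D : HWData`,
Huber–Wüstholz's clause (2) for `D.CurvePairs` together with a transfer datum from the curve-pair period structure into
`KZ.FormalRep ⧸ KZ.relations` in dimensions `≤ 1` yields `KZ_≤1`.  Both hypotheses explicit; nothing about `D` is assumed to
exist. [cite: HuberWustholz2022, Thm 13.3(2) p.121] -/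
theorem KZ_le_one_of_HW_Thm13_3_2 (D : HWData) (hHW : HW_Thm13_3_2 D)
    (hT : TransferDatum D.CurvePairs.periodStructure relations 1) : KZ_le 1 :=
  KZ_le_of_transfer hHW hT

/-- Same in the truncated calculus (cell referee R0-4): clause (2) plus a transfer datum modulo `KZ.relationsLE 1` gives
`KZ_leLE 1`. [cite: HuberWustholz2022, Thm 13.3(2) p.121] -/
theorem KZ_leLE_one_of_HW_Thm13_3_2 (D : HWData) (hHW : HW_Thm13_3_2 D)
    (hT : TransferDatum D.CurvePairs.periodStructure (relationsLE 1) 1) : KZ_leLE 1 :=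
  KZ_leLE_of_transfer hHW hT

/-- And from clause (3) (relations (A), (B), (C) in cohomological degree `≤ 1`). [cite: HuberWustholz2022, Thm 13.3(3) p.121] -/
theorem KZ_le_one_of_HW_Thm13_3_3 (D : HWData) (hHW : HW_Thm13_3_3 D)
    (hT : TransferDatum D.PairsLe1.periodStructureABC relations 1) : KZ_le 1 :=
  KZ_le_of_transfer hHW hT

/-- The general-`d` form for 1-motives [HW, Thm 9.10 / 13.3(1)]: clause (1) plus a transfer datum from `1-Mot_ℚ̄` modulo `R`
in dimensions `≤ d` gives `[r] − [r'] ∈ R` for equal values in dimensions `≤ d` — for `d ≥ 2` the transfer hypothesis is of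
course not expected to be available (periods of 1-motives are 1-periods, [HW, Cor. 12.12 p. 120]); stated to make the dependence on
`d` visible. [cite: HuberWustholz2022, Thm 9.10 p.91] -/
theorem KZ_le_of_HW_Thm13_3_1 (D : HWData) (hHW : HW_Thm13_3_1 D) {d : ℕ}
    (hT : TransferDatum D.OneMot.periodStructure relations d) : KZ_le d :=
  KZ_le_of_transfer hHW hT

end Summit.KontsevichZagierPeriods.KzOnePeriods
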